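import Mathlib
import HarnessLib

/-!
# QUANT lane R8, T-DEC: the TWO-ROW dual criterion — a piecewise-linear convex function of one price ratio is bounded below by a line iff it is
# at the two ends and at its kinks; hence the two-row transport inequality from finitely many checks (arm-1 gen 59, architect)

builds on p205010 (kernel theorem, internal audit signed; external expert review pending)

Support file (`--supports stmt-CriticalPhenomena-4575`), QUANT lane seat prim-quant-arm-1 (gen 59); memo `run/shared/lean/prim/quant/prim-quant-arm-1-g59/ARCH-G59.md`
§4.  Pure real algebra, no definitions; standard axioms, no sorries.  This is the row-space analogue of `GluedWindow.twoCol_breakpoint`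
(`…QuantGluedWindowIneq`), stated ORDER-FREE: for two rows (weights `w₀, w₁ ≥ 0`, price variables `λ₀, λ₁`) and finitely many columns `a`
(capacity `c a ≥ 0`, INVERSE rates `i a, j a ≥ 0` of the two rows — `0` encodes an incompatible column) with prices `p a ≥ 0` dominating
`λ₀ i a` and `λ₁ j a`, the inequality `w₀λ₀ + w₁λ₁ ≤ Σ_a c a · p a` holds for ALL such prices as soon as the homogeneous convex piecewise-linear
function `Φ(λ₀, λ₁) = Σ_a c a · max(λ₀ i a, λ₁ j a)` dominates `w₀λ₀ + w₁λ₁` at the two ends `(1,0)`, `(0,1)` and at the kink `(j b, i b)` of every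
column `b` (**`twoRow_dual`**; segment form **`twoRow_segment`**, homogeneous form **`twoRow_kinks`**).  In the two-row regime of LEMMA W
(`2(l+r) < T ≤ 2(l+r+k)`, memo §4) the rows are the two low copies `l, l+r` of the low atom and the columns are the mid copies `l+r+k, h, h+r` and
the pool; each cell then owes `2 + #columns` explicit inequalities and no enumeration of the ≈ 20 observed orders of the kinks.

HONEST STATUS.  `GluedLemmaW` (flow form), `GluedDominatedMass`, the band, `SiblingStep`, `FarTreeRow` OPEN; RATE class (log\*) / honest sentence of
`run/shared/lean/prim/quant/README.md` unchanged.  [this work] — elementary convexity, [folklore].  Nothing here is cited as a published result.  The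
gluing rows served [cite: KozmaNitzan2024, Conjecture 3 (p. 15)]; product measure [cite: Grimmett1999, §1.3 p. 10].
-/

namespace Summit.CriticalPhenomena.PercolationContinuityZ3.Theorems
namespace Quant
namespace LawDec
namespace GluedWindow

open Finset

variable {ι : Type*}

/-- the upper piece of a column's term: for `τ ≥ i/(i+j)` (with `i, j ≥ 0`), `max((1−τ) i, τ j) = τ j`. [folklore] -/
theorem kink_piece_hi (i j τ : ℝ) (hi : 0 ≤ i) (hj : 0 ≤ j) (hτ : i / (i + j) ≤ τ) : max ((1 - τ) * i) (τ * j) = τ * j := by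
  refine max_eq_right ?_
  rcases eq_or_lt_of_le (add_nonneg hi hj) with hz | hpos
  · have hi0 : i = 0 := by linarith
    have hj0 : j = 0 := by linarith
    simp [hi0, hj0]
  · have : i ≤ τ * (i + j) := by rwa [div_le_iff₀ hpos] at hτ
    nlinarith

/-- the lower piece of a column's term: for `τ ≤ i/(i+j)` (with `i, j ≥ 0`), `max((1−τ) i, τ j) = (1−τ) i`. [folklore] -/
theorem kink_piece_lo (i j τ : ℝ) (hi : 0 ≤ i) (hj : 0 ≤ j) (hτ : τ ≤ i / (i + j)) : max ((1 - τ) * i) (τ * j) = (1 - τ) * i := by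
  refine max_eq_left ?_
  rcases eq_or_lt_of_le (add_nonneg hi hj) with hz | hpos
  · have hi0 : i = 0 := by linarith
    have hj0 : j = 0 := by linarith
    simp [hi0, hj0]
  · have : τ * (i + j) ≤ i := by rwa [le_div_iff₀ hpos] at hτ
    nlinarith

/-- **SEGMENT FORM.**  On a segment `[L, U]` of the price-ratio parameter `τ`, the convex piecewise-linear `Φ(τ) = Σ_{a∈s} c a · max((1−τ) i a, τ j a)`
(`c, i, j ≥ 0` on `s`) lies above the line `w₀(1−τ) + w₁τ` as soon as it does at `L`, at `U`, and at every kink `i b/(i b + j b) ∈ (L, U)`, `b ∈ s`.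
(Induction on `s`: the last column's term is affine on either side of its kink.) [folklore] -/
theorem twoRow_segment [DecidableEq ι] (s : Finset ι) (c i j : ι → ℝ) (hc : ∀ a ∈ s, 0 ≤ c a) (hi : ∀ a ∈ s, 0 ≤ i a) (hj : ∀ a ∈ s, 0 ≤ j a) :
    ∀ (L U w0 w1 : ℝ), L ≤ U →
      w0 * (1 - L) + w1 * L ≤ ∑ a ∈ s, c a * max ((1 - L) * i a) (L * j a) →
      w0 * (1 - U) + w1 * U ≤ ∑ a ∈ s, c a * max ((1 - U) * i a) (U * j a) →
      (∀ b ∈ s, L < i b / (i b + j b) → i b / (i b + j b) < U →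
        w0 * (1 - i b / (i b + j b)) + w1 * (i b / (i b + j b))
          ≤ ∑ a ∈ s, c a * max ((1 - i b / (i b + j b)) * i a) (i b / (i b + j b) * j a)) →
      ∀ τ, L ≤ τ → τ ≤ U → w0 * (1 - τ) + w1 * τ ≤ ∑ a ∈ s, c a * max ((1 - τ) * i a) (τ * j a) := by
  induction s using Finset.induction_on with
  | empty =>
    intro L U w0 w1 hLU hL hU _ τ hLτ hτU
    simp only [Finset.sum_empty] at hL hU ⊢
    rcases le_or_gt w0 w1 with h | h
    · nlinarith [mul_le_mul_of_nonneg_left hτU (sub_nonneg.2 h)]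
    · nlinarith [mul_le_mul_of_nonneg_left hLτ (sub_nonneg.2 h.le)]
  | @insert b s hb ih =>
    intro L U w0 w1 hLU hL hU hK τ hLτ hτU
    have hc' : ∀ a ∈ s, 0 ≤ c a := fun a ha => hc a (Finset.mem_insert_of_mem ha)
    have hi' : ∀ a ∈ s, 0 ≤ i a := fun a ha => hi a (Finset.mem_insert_of_mem ha)
    have hj' : ∀ a ∈ s, 0 ≤ j a := fun a ha => hj a (Finset.mem_insert_of_mem ha)
    have hcb : 0 ≤ c b := hc b (Finset.mem_insert_self b s)
    have hib : 0 ≤ i b := hi b (Finset.mem_insert_self b s)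
    have hjb : 0 ≤ j b := hj b (Finset.mem_insert_self b s)
    simp only [Finset.sum_insert hb] at hL hU hK ⊢
    set κ : ℝ := i b / (i b + j b) with hκ
    -- above the new kink: the new term is `c b · τ · j b`; induct with `w1 - c b * j b`
    have HI : ∀ L' U', κ ≤ L' → L ≤ L' → U' ≤ U → L' ≤ U' →
        w0 * (1 - L') + w1 * L' ≤ c b * max ((1 - L') * i b) (L' * j b) + ∑ a ∈ s, c a * max ((1 - L') * i a) (L' * j a) →
        w0 * (1 - U') + w1 * U' ≤ c b * max ((1 - U') * i b) (U' * j b) + ∑ a ∈ s, c a * max ((1 - U') * i a) (U' * j a) →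
        ∀ τ', L' ≤ τ' → τ' ≤ U' →
          w0 * (1 - τ') + w1 * τ' ≤ c b * max ((1 - τ') * i b) (τ' * j b) + ∑ a ∈ s, c a * max ((1 - τ') * i a) (τ' * j a) := by
      intro L' U' hκL' hLL' hU'U hL'U' h1 h2 τ' hτ1 hτ2
      rw [kink_piece_hi (i b) (j b) L' hib hjb hκL'] at h1
      rw [kink_piece_hi (i b) (j b) U' hib hjb (le_trans hκL' hL'U')] at h2
      rw [kink_piece_hi (i b) (j b) τ' hib hjb (le_trans hκL' hτ1)]
      have h3 : ∀ a ∈ s, L' < i a / (i a + j a) → i a / (i a + j a) < U' →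
          w0 * (1 - i a / (i a + j a)) + (w1 - c b * j b) * (i a / (i a + j a))
            ≤ ∑ a' ∈ s, c a' * max ((1 - i a / (i a + j a)) * i a') (i a / (i a + j a) * j a') := by
        intro a ha h1a h2a
        have := hK a (Finset.mem_insert_of_mem ha) (lt_of_le_of_lt hLL' h1a) (lt_of_lt_of_le h2a hU'U)
        rw [kink_piece_hi (i b) (j b) _ hib hjb (le_trans hκL' h1a.le)] at this
        linarith
      have := ih hc' hi' hj' L' U' w0 (w1 - c b * j b) hL'U' (by linarith) (by linarith) h3 τ' hτ1 hτ2
      linarith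
    -- below the new kink: the new term is `c b · (1−τ) · i b`; induct with `w0 - c b * i b`
    have LO : ∀ L' U', U' ≤ κ → L ≤ L' → U' ≤ U → L' ≤ U' →
        w0 * (1 - L') + w1 * L' ≤ c b * max ((1 - L') * i b) (L' * j b) + ∑ a ∈ s, c a * max ((1 - L') * i a) (L' * j a) →
        w0 * (1 - U') + w1 * U' ≤ c b * max ((1 - U') * i b) (U' * j b) + ∑ a ∈ s, c a * max ((1 - U') * i a) (U' * j a) →
        ∀ τ', L' ≤ τ' → τ' ≤ U' →
          w0 * (1 - τ') + w1 * τ' ≤ c b * max ((1 - τ') * i b) (τ' * j b) + ∑ a ∈ s, c a * max ((1 - τ') * i a) (τ' * j a) := by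
      intro L' U' hU'κ hLL' hU'U hL'U' h1 h2 τ' hτ1 hτ2
      rw [kink_piece_lo (i b) (j b) L' hib hjb (le_trans hL'U' hU'κ)] at h1
      rw [kink_piece_lo (i b) (j b) U' hib hjb hU'κ] at h2
      rw [kink_piece_lo (i b) (j b) τ' hib hjb (le_trans hτ2 hU'κ)]
      have h3 : ∀ a ∈ s, L' < i a / (i a + j a) → i a / (i a + j a) < U' →
          (w0 - c b * i b) * (1 - i a / (i a + j a)) + w1 * (i a / (i a + j a))
            ≤ ∑ a' ∈ s, c a' * max ((1 - i a / (i a + j a)) * i a') (i a / (i a + j a) * j a') := by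
        intro a ha h1a h2a
        have := hK a (Finset.mem_insert_of_mem ha) (lt_of_le_of_lt hLL' h1a) (lt_of_lt_of_le h2a hU'U)
        rw [kink_piece_lo (i b) (j b) _ hib hjb (le_trans h2a.le hU'κ)] at this
        linarith
      have := ih hc' hi' hj' L' U' (w0 - c b * i b) w1 hL'U' (by linarith) (by linarith) h3 τ' hτ1 hτ2
      linarith
    rcases le_or_gt κ L with hκL | hκL
    · exact HI L U hκL le_rfl le_rfl hLU hL hU τ hLτ hτU
    rcases le_or_gt U κ with hUκ | hUκ
    · exact LO L U hUκ le_rfl le_rfl hLU hL hU τ hLτ hτU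
    -- the new kink is interior: Φ(κ) ≥ line(κ) by hypothesis; split the segment at κ
    have hmid := hK b (Finset.mem_insert_self b s) hκL hUκ
    rcases le_total τ κ with hτκ | hτκ
    · exact LO L κ le_rfl le_rfl hUκ.le hκL.le hL hmid τ hLτ hτκ
    · exact HI κ U le_rfl hκL.le le_rfl hUκ.le hmid hU τ hτκ hτU

/-- **HOMOGENEOUS (KINK) FORM.**  With columns `a ∈ s` of capacity `c a ≥ 0` and inverse rates `i a, j a ≥ 0`: if `w₀ ≤ Σ c a · i a` (the end
`(λ₀,λ₁) = (1,0)`), `w₁ ≤ Σ c a · j a` (the end `(0,1)`), and `w₀ j b + w₁ i b ≤ Σ_a c a · max(j b · i a, i b · j a)` for every column `b ∈ s` (the kink of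
column `b`), then `w₀λ₀ + w₁λ₁ ≤ Σ_a c a · max(λ₀ i a, λ₁ j a)` for all `λ₀, λ₁ ≥ 0`. [folklore] -/
theorem twoRow_kinks [DecidableEq ι] (s : Finset ι) (c i j : ι → ℝ) (hc : ∀ a ∈ s, 0 ≤ c a) (hi : ∀ a ∈ s, 0 ≤ i a) (hj : ∀ a ∈ s, 0 ≤ j a)
    (w0 w1 : ℝ) (h10 : w0 ≤ ∑ a ∈ s, c a * i a) (h01 : w1 ≤ ∑ a ∈ s, c a * j a)
    (hk : ∀ b ∈ s, w0 * j b + w1 * i b ≤ ∑ a ∈ s, c a * max (j b * i a) (i b * j a))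
    (v0 v1 : ℝ) (hv0 : 0 ≤ v0) (hv1 : 0 ≤ v1) :
    w0 * v0 + w1 * v1 ≤ ∑ a ∈ s, c a * max (v0 * i a) (v1 * j a) := by
  rcases eq_or_lt_of_le (add_nonneg hv0 hv1) with hz | hpos
  · have e0 : v0 = 0 := by linarith
    have e1 : v1 = 0 := by linarith
    simp [e0, e1]
  -- normalise to the segment: τ = v1/(v0+v1)
  set σ : ℝ := v0 + v1 with hσ
  set τ : ℝ := v1 / σ with hτ
  have hτ0 : 0 ≤ τ := div_nonneg hv1 hpos.le
  have hτ1 : τ ≤ 1 := by rw [hτ, div_le_one hpos]; linarith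
  have e1 : v1 = σ * τ := by rw [hτ]; field_simp
  have e0 : v0 = σ * (1 - τ) := by
    have : σ * (1 - τ) = σ - σ * τ := by ring
    rw [this, ← e1]; linarith
  -- the segment hypotheses
  have hL : w0 * (1 - 0) + w1 * 0 ≤ ∑ a ∈ s, c a * max ((1 - 0) * i a) (0 * j a) := by
    have : ∑ a ∈ s, c a * max ((1 - (0:ℝ)) * i a) (0 * j a) = ∑ a ∈ s, c a * i a := by
      refine Finset.sum_congr rfl fun a ha => ?_
      rw [sub_zero, one_mul, zero_mul, max_eq_left (hi a ha)]
    rw [this]; linarith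
  have hU : w0 * (1 - 1) + w1 * 1 ≤ ∑ a ∈ s, c a * max ((1 - 1) * i a) (1 * j a) := by
    have : ∑ a ∈ s, c a * max ((1 - (1:ℝ)) * i a) (1 * j a) = ∑ a ∈ s, c a * j a := by
      refine Finset.sum_congr rfl fun a ha => ?_
      rw [sub_self, zero_mul, one_mul, max_eq_right (hj a ha)]
    rw [this]; linarith
  have hK : ∀ b ∈ s, (0:ℝ) < i b / (i b + j b) → i b / (i b + j b) < 1 →
      w0 * (1 - i b / (i b + j b)) + w1 * (i b / (i b + j b))
        ≤ ∑ a ∈ s, c a * max ((1 - i b / (i b + j b)) * i a) (i b / (i b + j b) * j a) := by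
    intro b hb h1 _
    have hib := hi b hb; have hjb := hj b hb
    have hpos' : 0 < i b + j b := by
      rcases eq_or_lt_of_le (add_nonneg hib hjb) with hz | hp'
      · exfalso; rw [← hz, div_zero] at h1; exact lt_irrefl _ h1
      · exact hp'
    have ek : 1 - i b / (i b + j b) = j b / (i b + j b) := by field_simp; ring
    rw [ek]
    have : ∑ a ∈ s, c a * max (j b / (i b + j b) * i a) (i b / (i b + j b) * j a)
        = (1 / (i b + j b)) * ∑ a ∈ s, c a * max (j b * i a) (i b * j a) := by
      rw [Finset.mul_sum]
      refine Finset.sum_congr rfl fun a _ => ?_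
      have hd : 0 ≤ 1 / (i b + j b) := by positivity
      rw [← mul_assoc, mul_comm (1 / (i b + j b)) (c a), mul_assoc, mul_max_of_nonneg _ _ hd]
      congr 1; congr 1 <;> ring
    rw [this]
    have hkb := hk b hb
    have hd : 0 < 1 / (i b + j b) := by positivity
    have := mul_le_mul_of_nonneg_left hkb hd.le
    have e : 1 / (i b + j b) * (w0 * j b + w1 * i b) = w0 * (j b / (i b + j b)) + w1 * (i b / (i b + j b)) := by
      field_simp
    linarith
  have seg := twoRow_segment s c i j hc hi hj 0 1 w0 w1 zero_le_one hL hU hK τ hτ0 hτ1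
  -- scale back by σ > 0
  have hs := mul_le_mul_of_nonneg_left seg hpos.le
  have : σ * ∑ a ∈ s, c a * max ((1 - τ) * i a) (τ * j a) = ∑ a ∈ s, c a * max (v0 * i a) (v1 * j a) := by
    rw [Finset.mul_sum]
    refine Finset.sum_congr rfl fun a _ => ?_
    rw [← mul_assoc, mul_comm σ (c a), mul_assoc, mul_max_of_nonneg _ _ hpos.le, e0, e1]
    congr 1; congr 1 <;> ring
  rw [← this]
  have e : w0 * v0 + w1 * v1 = σ * (w0 * (1 - τ) + w1 * τ) := by rw [e0, e1]; ring
  rw [e]; exact hs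

/-- **THE TWO-ROW DUAL INEQUALITY FROM THE KINK CHECKS.**  Rows `0, 1` with weights `w₀, w₁ ≥ 0` and values `λ₀, λ₁` (any sign); columns `a ∈ s` with
capacities `c a ≥ 0`, prices `p a ≥ 0` and inverse rates `i a, j a ≥ 0` such that `λ₀ · i a ≤ p a` and `λ₁ · j a ≤ p a` (i.e. `λ₀ ≤ rate₀(a)·p a` for the
compatible columns).  If the ends and the kinks check (`twoRow_kinks`), then `w₀λ₀ + w₁λ₁ ≤ Σ_a c a · p a`. [this work] -/
theorem twoRow_dual [DecidableEq ι] (s : Finset ι) (c i j p : ι → ℝ) (hc : ∀ a ∈ s, 0 ≤ c a) (hi : ∀ a ∈ s, 0 ≤ i a) (hj : ∀ a ∈ s, 0 ≤ j a)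
    (hp : ∀ a ∈ s, 0 ≤ p a) (w0 w1 v0 v1 : ℝ) (hw0 : 0 ≤ w0) (hw1 : 0 ≤ w1)
    (hv0 : ∀ a ∈ s, v0 * i a ≤ p a) (hv1 : ∀ a ∈ s, v1 * j a ≤ p a)
    (h10 : w0 ≤ ∑ a ∈ s, c a * i a) (h01 : w1 ≤ ∑ a ∈ s, c a * j a)
    (hk : ∀ b ∈ s, w0 * j b + w1 * i b ≤ ∑ a ∈ s, c a * max (j b * i a) (i b * j a)) :
    w0 * v0 + w1 * v1 ≤ ∑ a ∈ s, c a * p a := by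
  have m0 : 0 ≤ max v0 0 := le_max_right _ _
  have m1 : 0 ≤ max v1 0 := le_max_right _ _
  have step1 : w0 * v0 + w1 * v1 ≤ w0 * max v0 0 + w1 * max v1 0 := by
    nlinarith [mul_le_mul_of_nonneg_left (le_max_left v0 0) hw0, mul_le_mul_of_nonneg_left (le_max_left v1 0) hw1]
  have step2 := twoRow_kinks s c i j hc hi hj w0 w1 h10 h01 hk (max v0 0) (max v1 0) m0 m1
  have step3 : ∑ a ∈ s, c a * max (max v0 0 * i a) (max v1 0 * j a) ≤ ∑ a ∈ s, c a * p a := by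
    refine Finset.sum_le_sum fun a ha => mul_le_mul_of_nonneg_left ?_ (hc a ha)
    refine max_le ?_ ?_
    · rcases le_total v0 0 with h | h
      · rw [max_eq_right h, zero_mul]; exact hp a ha
      · rw [max_eq_left h]; exact hv0 a ha
    · rcases le_total v1 0 with h | h
      · rw [max_eq_right h, zero_mul]; exact hp a ha
      · rw [max_eq_left h]; exact hv1 a ha
  linarith

/-- `twoRow_dual` for THREE explicit columns `a, b, c` (capacities `ca, cb, cc`, inverse rates `(ia, ja), (ib, jb), (ic, jc)`, prices `pa, pb, pc`):
two end checks and three kink checks give `w₀v₀ + w₁v₁ ≤ ca·pa + cb·pb + cc·pc`. [this work] -/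
theorem twoRow_dual_three (w0 w1 v0 v1 ca cb cc ia ib ic ja jb jc pa pb pc : ℝ) (hw0 : 0 ≤ w0) (hw1 : 0 ≤ w1)
    (hca : 0 ≤ ca) (hcb : 0 ≤ cb) (hcc : 0 ≤ cc) (hia : 0 ≤ ia) (hib : 0 ≤ ib) (hic : 0 ≤ ic) (hja : 0 ≤ ja) (hjb : 0 ≤ jb) (hjc : 0 ≤ jc)
    (hpa : 0 ≤ pa) (hpb : 0 ≤ pb) (hpc : 0 ≤ pc)
    (h0a : v0 * ia ≤ pa) (h0b : v0 * ib ≤ pb) (h0c : v0 * ic ≤ pc) (h1a : v1 * ja ≤ pa) (h1b : v1 * jb ≤ pb) (h1c : v1 * jc ≤ pc)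
    (h10 : w0 ≤ ca * ia + cb * ib + cc * ic) (h01 : w1 ≤ ca * ja + cb * jb + cc * jc)
    (hka : w0 * ja + w1 * ia ≤ ca * max (ja * ia) (ia * ja) + cb * max (ja * ib) (ia * jb) + cc * max (ja * ic) (ia * jc))
    (hkb : w0 * jb + w1 * ib ≤ ca * max (jb * ia) (ib * ja) + cb * max (jb * ib) (ib * jb) + cc * max (jb * ic) (ib * jc))
    (hkc : w0 * jc + w1 * ic ≤ ca * max (jc * ia) (ic * ja) + cb * max (jc * ib) (ic * jb) + cc * max (jc * ic) (ic * jc)) :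
    w0 * v0 + w1 * v1 ≤ ca * pa + cb * pb + cc * pc := by
  have key := twoRow_dual (Finset.univ : Finset (Fin 3)) ![ca, cb, cc] ![ia, ib, ic] ![ja, jb, jc] ![pa, pb, pc]
    (by intro a _; fin_cases a <;> assumption) (by intro a _; fin_cases a <;> assumption) (by intro a _; fin_cases a <;> assumption)
    (by intro a _; fin_cases a <;> assumption) w0 w1 v0 v1 hw0 hw1
    (by intro a _; fin_cases a <;> assumption) (by intro a _; fin_cases a <;> assumption)
    (by simpa [Fin.sum_univ_three] using h10) (by simpa [Fin.sum_univ_three] using h01)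
    (by intro b _; fin_cases b <;> simp [Fin.sum_univ_three] <;> assumption)
  simpa [Fin.sum_univ_three] using key

/-- `twoRow_dual` for FOUR explicit columns (the two-row regime of LEMMA W: the columns `l+r+k`, `h`, `h+r` and the pool). [this work] -/
theorem twoRow_dual_four (w0 w1 v0 v1 ca cb cc cd ia ib ic id ja jb jc jd pa pb pc pd : ℝ) (hw0 : 0 ≤ w0) (hw1 : 0 ≤ w1)
    (hca : 0 ≤ ca) (hcb : 0 ≤ cb) (hcc : 0 ≤ cc) (hcd : 0 ≤ cd) (hia : 0 ≤ ia) (hib : 0 ≤ ib) (hic : 0 ≤ ic) (hid : 0 ≤ id)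
    (hja : 0 ≤ ja) (hjb : 0 ≤ jb) (hjc : 0 ≤ jc) (hjd : 0 ≤ jd) (hpa : 0 ≤ pa) (hpb : 0 ≤ pb) (hpc : 0 ≤ pc) (hpd : 0 ≤ pd)
    (h0a : v0 * ia ≤ pa) (h0b : v0 * ib ≤ pb) (h0c : v0 * ic ≤ pc) (h0d : v0 * id ≤ pd)
    (h1a : v1 * ja ≤ pa) (h1b : v1 * jb ≤ pb) (h1c : v1 * jc ≤ pc) (h1d : v1 * jd ≤ pd)
    (h10 : w0 ≤ ca * ia + cb * ib + cc * ic + cd * id) (h01 : w1 ≤ ca * ja + cb * jb + cc * jc + cd * jd)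
    (hka : w0 * ja + w1 * ia ≤ ca * max (ja * ia) (ia * ja) + cb * max (ja * ib) (ia * jb) + cc * max (ja * ic) (ia * jc) + cd * max (ja * id) (ia * jd))
    (hkb : w0 * jb + w1 * ib ≤ ca * max (jb * ia) (ib * ja) + cb * max (jb * ib) (ib * jb) + cc * max (jb * ic) (ib * jc) + cd * max (jb * id) (ib * jd))
    (hkc : w0 * jc + w1 * ic ≤ ca * max (jc * ia) (ic * ja) + cb * max (jc * ib) (ic * jb) + cc * max (jc * ic) (ic * jc) + cd * max (jc * id) (ic * jd))
    (hkd : w0 * jd + w1 * id ≤ ca * max (jd * ia) (id * ja) + cb * max (jd * ib) (id * jb) + cc * max (jd * ic) (id * jc) + cd * max (jd * id) (id * jd)) :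
    w0 * v0 + w1 * v1 ≤ ca * pa + cb * pb + cc * pc + cd * pd := by
  have key := twoRow_dual (Finset.univ : Finset (Fin 4)) ![ca, cb, cc, cd] ![ia, ib, ic, id] ![ja, jb, jc, jd] ![pa, pb, pc, pd]
    (by intro a _; fin_cases a <;> assumption) (by intro a _; fin_cases a <;> assumption) (by intro a _; fin_cases a <;> assumption)
    (by intro a _; fin_cases a <;> assumption) w0 w1 v0 v1 hw0 hw1
    (by intro a _; fin_cases a <;> assumption) (by intro a _; fin_cases a <;> assumption)
    (by simpa [Fin.sum_univ_four] using h10) (by simpa [Fin.sum_univ_four] using h01)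
    (by intro b _; fin_cases b <;> simp [Fin.sum_univ_four] <;> assumption)
  simpa [Fin.sum_univ_four] using key

end GluedWindow
end LawDec
end Quant
end Summit.CriticalPhenomena.PercolationContinuityZ3.Theorems
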